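/-
Copyright (c) 2026. All rights reserved.
Released under Apache 2.0 license as described in the file LICENSE.
Authors: abc-iut cell, seat abc-iut-L4-t12 (Def 3.5 toolkit; discharge of [AbsTopIII] Cor 3.7 (ii)).
-/
import Literature.AnabelianGeometry.AbsoluteAnabelian.StrictHomotopyFamilies
import Mathlib.CategoryTheory.Category.Cat

/-!
# Families of homotopies from a pseudo-commuting shadow ([AbsTopIII] Def 3.5 (ii); technical
# companion of `DiagramsOfCategories.lean` / `StrictHomotopyFamilies.lean`)

S. Mochizuki, *Topics in Absolute Anabelian Geometry III* (`MochizukiAbsTopIII2015`; locators =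
kurims manuscript pages, lit key `paper:url-5493eb38cbb7`), Def 3.5 (i)–(ii) pp. 74–75.  The cores,
telecores and "generated" families of homotopies of Cor 3.6 / 3.7 / 4.5 all come from ONE pattern,
made generic here (seat abc-iut-L4-t12; generalises the strict shadow of
`AbsTopIII/BiAnabelianTelecoreFamily.lean` and the augmentations of `AugmentedCores.lean` /
`DiagramCores.lean`): a **pseudo-commuting shadow** of a diagram of categories `𝒟` = shadow
categories `Sh v`, augmentations `aug_v : 𝒟_v ⥤ Sh v`, shadow functors `sh_e` on edges, coherence
isomorphisms `can_e : 𝒟_e ⋙ aug_w ≅ aug_v ⋙ sh_e`; along a path, `sh_[γ]` and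
`can_[γ] : 𝒟_[γ] ⋙ aug_w ≅ aug_v ⋙ sh_[γ]` (`shP`, `canP`; composition law `canH_comp`).  If the
augmentation at the terminal vertex is FULLY FAITHFUL, a co-verticial pair with EQUAL SHADOWS
`sh_[γ₁] = sh_[γ₂]` carries a UNIQUE homotopy `𝒟_[γ₁] ⟶ 𝒟_[γ₂]` over `can_[γ₁] ≫ can_[γ₂]⁻¹`
(`univ`, `univ_eq`), and uniqueness gives the axioms of Def 3.5 (ii) (`univ_refl/trans/whisker`):
`shadowFamily` (boundary set "equal shadows"), `HomotopyFamily.restrict` (restriction to a saturated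
sub-relation), `generatedFamily E₀` (boundary set EXACTLY the saturation of generators `E₀` with equal
shadows — "`ℋ` is generated by the homotopies indexed by `E₀`"; `generatedFamily_η_eq` characterises its
homotopies).  Over the structural `pathFunctor'`, transported to t2's `HomotopyFamily` by `mkOfStrict`.
Pure category theory; nothing here bears on [IUTchIII] Cor 3.12.
-/

namespace Literature.AnabelianGeometry.AbsoluteAnabelian

open _root_.CategoryTheory _root_.Quiver

universe v u w

namespace DiagramOfCategories

variable {V : Type w} [Quiver.{v} V]

/-! ## Restriction of a family of homotopies to a saturated sub-relation -/

/-- A family of homotopies restricted to a saturated subset of its boundary set (same homotopies). [cite: MochizukiAbsTopIII2015, Definition 3.5 (ii) p.75] -/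
def HomotopyFamily.restrict {D : DiagramOfCategories.{v, u, w} V} (H : D.HomotopyFamily)
    (E' : ∀ ⦃a b : V⦄, Path a b → Path a b → Prop) (hE' : IsSaturated E')
    (hsub : ∀ ⦃a b : V⦄ ⦃p q : Path a b⦄, E' p q → H.E p q) : D.HomotopyFamily where
  E := E'
  isSaturated := hE'
  η := fun ⦃_ _⦄ ⦃_ _⦄ h => H.η (hsub h)
  η_refl := fun ⦃_ _⦄ ⦃_⦄ h => H.η_refl (hsub h)
  η_trans := fun ⦃_ _⦄ ⦃_ _ _⦄ h₁ h₂ => H.η_trans (hsub h₁) (hsub h₂)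
  η_whisker := fun ⦃_ _ _ _⦄ ⦃_ _⦄ h r₁ r₂ => H.η_whisker (hsub h) r₁ r₂

/-- The saturation of a set of pairs contained in a saturated set stays inside it. [cite: MochizukiAbsTopIII2015, Section 0 p.27] -/
theorem saturation_le {E₀ E : ∀ ⦃a b : V⦄, Path a b → Path a b → Prop} (hE : IsSaturated E)
    (h₀ : ∀ ⦃a b : V⦄ ⦃p q : Path a b⦄, E₀ p q → E p q) {a b : V} {p q : Path a b}
    (h : Saturation E₀ p q) : E p q := by
  induction h with
  | base h => exact h₀ h
  | refl_left _ ih => exact hE.refl_left ih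
  | refl_right _ ih => exact hE.refl_right ih
  | trans _ _ ih₁ ih₂ => exact hE.trans ih₁ ih₂
  | precomp r _ ih => exact hE.precomp ih r
  | postcomp r _ ih => exact hE.postcomp ih r

variable (D : DiagramOfCategories.{v, u, w} V)

/-! ## Pseudo-commuting shadows -/

/-- A **pseudo-commuting shadow** of a diagram of categories `𝒟`: shadow categories, augmentations,
shadow functors on edges and the coherence isomorphisms `can_e : 𝒟_e ⋙ aug_w ≅ aug_v ⋙ sh_e` (for
the cores of Cor 3.6 (i) / 3.7 (i) all `sh_e` are identities; for Cor 3.7 (ii) the only non-trivial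
`can_e` is `θ^bi`). [cite: MochizukiAbsTopIII2015, Definition 3.5 (ii) p.75] -/
structure PseudoShadow : Type (max w (v + 1) (u + 1)) where
  /-- the shadow category at a vertex (bundled) -/
  Sh : V → Cat.{v, u}
  /-- the augmentation `𝒟_v ⥤ Sh v` -/
  aug : ∀ a : V, D.obj a ⥤ Sh a
  /-- the shadow of an edge -/
  she : ∀ {a b : V}, (a ⟶ b) → (Sh a ⥤ Sh b)
  /-- the coherence isomorphism of an edge -/
  can : ∀ {a b : V} (e : a ⟶ b), D.map e ⋙ aug b ≅ aug a ⋙ she e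


namespace PseudoShadow

variable {D} (S : D.PseudoShadow)

/-- The shadow `sh_[γ]` of a path (structural recursion). [cite: MochizukiAbsTopIII2015, Definition 3.5 (i) p.74] -/
def shP {a : V} : ∀ {b : V}, Path a b → (S.Sh a ⥤ S.Sh b)
  | _, .nil => 𝟭 _
  | _, .cons p e => shP p ⋙ S.she e

/-- `sh_[nil] = 𝟭`. [cite: MochizukiAbsTopIII2015, Definition 3.5 (i) p.74] -/
@[simp] theorem shP_nil (a : V) : S.shP (Path.nil : Path a a) = 𝟭 _ := rfl

/-- `sh_[γ.cons e] = sh_[γ] ⋙ sh_e`. [cite: MochizukiAbsTopIII2015, Definition 3.5 (i) p.74] -/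
@[simp] theorem shP_cons {a b c : V} (p : Path a b) (e : b ⟶ c) :
    S.shP (p.cons e) = S.shP p ⋙ S.she e := rfl

/-- `sh_[γ₂ ∘ γ₁] = sh_[γ₁] ⋙ sh_[γ₂]`. [cite: MochizukiAbsTopIII2015, Definition 3.5 (i) p.75] -/
theorem shP_comp {a b : V} (p : Path a b) : ∀ {c : V} (q : Path b c),
    S.shP (p.comp q) = S.shP p ⋙ S.shP q
  | _, .nil => (Functor.comp_id _).symm
  | _, .cons q e => by rw [Path.comp_cons, shP_cons, shP_cons, shP_comp p q]; rfl

/-- Objects: `sh_[γ₂ ∘ γ₁] y = sh_[γ₂] (sh_[γ₁] y)`. [cite: MochizukiAbsTopIII2015, Definition 3.5 (i) p.75] -/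
theorem shP_comp_obj {a b c : V} (p : Path a b) (q : Path b c) (y : S.Sh a) :
    (S.shP (p.comp q)).obj y = (S.shP q).obj ((S.shP p).obj y) :=
  Functor.congr_obj (S.shP_comp p q) y

/-- "Equal shadows" is a saturated set of co-verticial pairs. [cite: MochizukiAbsTopIII2015, Section 0 p.26] -/
theorem isSaturated_shEq : IsSaturated (fun ⦃_ _ : V⦄ p q => S.shP p = S.shP q) where
  refl_left _ _ _ _ _ := rfl
  refl_right _ _ _ _ _ := rfl
  trans _ _ _ _ _ h₁ h₂ := h₁.trans h₂
  precomp _ _ _ _ _ h r := by simp only [shP_comp, h]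
  postcomp _ _ _ _ _ h r := by simp only [shP_comp, h]

/-- `sh_[γ₂ ∘ γ₁]` on morphisms, with the object identifications made explicit. [cite: MochizukiAbsTopIII2015, Definition 3.5 (i) p.75] -/
theorem shP_comp_map {a b c : V} (p : Path a b) (q : Path b c) {y y' : S.Sh a} (f : y ⟶ y') :
    (S.shP (p.comp q)).map f =
      eqToHom (S.shP_comp_obj p q y) ≫ (S.shP q).map ((S.shP p).map f) ≫
        eqToHom (S.shP_comp_obj p q y').symm :=
  Functor.congr_hom (S.shP_comp p q) f

/-- The coherence isomorphism `can_[γ] : 𝒟_[γ] ⋙ aug_w ≅ aug_v ⋙ sh_[γ]` of a path, by composing the edge 2-cells (structural recursion). [cite: MochizukiAbsTopIII2015, Definition 3.5 (ii) p.75] -/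
def canP {a : V} : ∀ {b : V} (p : Path a b), D.pathFunctor' p ⋙ S.aug b ≅ S.aug a ⋙ S.shP p
  | _, .nil => Iso.refl (S.aug a)
  | _, .cons p e =>
    Functor.isoWhiskerLeft (D.pathFunctor' p) (S.can e) ≪≫ Functor.isoWhiskerRight (canP p) (S.she e)

/-! ## Components in normal form (types written `G.obj (F.obj x)`, never `(F ⋙ G).obj x`) -/

/-- The edge 2-cell `can_e` at an object. [cite: MochizukiAbsTopIII2015, Definition 3.5 (ii) p.75] -/
def canE {a b : V} (e : a ⟶ b) (z : D.obj a) :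
    (S.aug b).obj ((D.map e).obj z) ⟶ (S.she e).obj ((S.aug a).obj z) := (S.can e).hom.app z

/-- The inverse edge 2-cell at an object. [cite: MochizukiAbsTopIII2015, Definition 3.5 (ii) p.75] -/
def canEI {a b : V} (e : a ⟶ b) (z : D.obj a) :
    (S.she e).obj ((S.aug a).obj z) ⟶ (S.aug b).obj ((D.map e).obj z) := (S.can e).inv.app z

/-- `can_[γ]` at an object. [cite: MochizukiAbsTopIII2015, Definition 3.5 (ii) p.75] -/
def canH {a b : V} (p : Path a b) (x : D.obj a) :
    (S.aug b).obj ((D.pathFunctor' p).obj x) ⟶ (S.shP p).obj ((S.aug a).obj x) := (S.canP p).hom.app x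

/-- `can_[γ]⁻¹` at an object. [cite: MochizukiAbsTopIII2015, Definition 3.5 (ii) p.75] -/
def canI {a b : V} (p : Path a b) (x : D.obj a) :
    (S.shP p).obj ((S.aug a).obj x) ⟶ (S.aug b).obj ((D.pathFunctor' p).obj x) := (S.canP p).inv.app x

/-- `can_[γ] ≫ can_[γ]⁻¹ = id`. [cite: MochizukiAbsTopIII2015, Definition 3.5 (ii) p.75] -/
@[reassoc (attr := simp)]
theorem canH_canI {a b : V} (p : Path a b) (x : D.obj a) : S.canH p x ≫ S.canI p x = 𝟙 _ :=
  (S.canP p).hom_inv_id_app x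

/-- `can_[γ]⁻¹ ≫ can_[γ] = id`. [cite: MochizukiAbsTopIII2015, Definition 3.5 (ii) p.75] -/
@[reassoc (attr := simp)]
theorem canI_canH {a b : V} (p : Path a b) (x : D.obj a) : S.canI p x ≫ S.canH p x = 𝟙 _ :=
  (S.canP p).inv_hom_id_app x

/-- Naturality of `can_[γ]`. [cite: MochizukiAbsTopIII2015, Definition 3.5 (ii) p.75] -/
@[reassoc]
theorem canH_naturality {a b : V} (p : Path a b) {x x' : D.obj a} (f : x ⟶ x') :
    (S.aug b).map ((D.pathFunctor' p).map f) ≫ S.canH p x' =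
      S.canH p x ≫ (S.shP p).map ((S.aug a).map f) :=
  (S.canP p).hom.naturality f

/-- `can_e` transports `eqToHom`s. [cite: MochizukiAbsTopIII2015, Definition 3.5 (ii) p.75] -/
@[reassoc]
theorem canE_eqToHom {a b : V} (e : a ⟶ b) {z z' : D.obj a} (h : z = z') :
    S.canE e z ≫ eqToHom (by rw [h]) = eqToHom (by rw [h]) ≫ S.canE e z' := by
  subst h; simp

/-- `can_e⁻¹` transports `eqToHom`s. [cite: MochizukiAbsTopIII2015, Definition 3.5 (ii) p.75] -/
@[reassoc]
theorem canEI_eqToHom {a b : V} (e : a ⟶ b) {z z' : D.obj a} (h : z = z') :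
    S.canEI e z ≫ eqToHom (by rw [h]) = eqToHom (by rw [h]) ≫ S.canEI e z' := by
  subst h; simp

/-- `can_[nil] = id`. [cite: MochizukiAbsTopIII2015, Definition 3.5 (ii) p.75] -/
@[simp] theorem canH_nil (a : V) (x : D.obj a) :
    S.canH (Path.nil : Path a a) x = 𝟙 ((S.aug a).obj x) := rfl

/-- `can_[γ.cons e] = can_e ≫ sh_e(can_[γ])`. [cite: MochizukiAbsTopIII2015, Definition 3.5 (ii) p.75] -/
theorem canH_cons {a b c : V} (p : Path a b) (e : b ⟶ c) (x : D.obj a) :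
    S.canH (p.cons e) x = S.canE e ((D.pathFunctor' p).obj x) ≫ (S.she e).map (S.canH p x) := rfl

/-- `can_[γ.cons e]⁻¹ = sh_e(can_[γ]⁻¹) ≫ can_e⁻¹`. [cite: MochizukiAbsTopIII2015, Definition 3.5 (ii) p.75] -/
theorem canI_cons {a b c : V} (p : Path a b) (e : b ⟶ c) (x : D.obj a) :
    S.canI (p.cons e) x = (S.she e).map (S.canI p x) ≫ S.canEI e ((D.pathFunctor' p).obj x) := rfl

/-- `sh_[γ.cons e]` on morphisms. [cite: MochizukiAbsTopIII2015, Definition 3.5 (i) p.75] -/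
theorem shP_cons_map {a b c : V} (p : Path a b) (e : b ⟶ c) {y y' : S.Sh a} (f : y ⟶ y') :
    (S.shP (p.cons e)).map f = (S.she e).map ((S.shP p).map f) := rfl

/-- Composition law `can_[γ₂ ∘ γ₁](x) = can_[γ₂](𝒟_[γ₁] x) ≫ sh_[γ₂](can_[γ₁](x))` (up to the object identifications). [cite: MochizukiAbsTopIII2015, Definition 3.5 (ii) p.75] -/
theorem canH_comp {c a : V} (r : Path c a) : ∀ {b : V} (p : Path a b) (x : D.obj c),
    S.canH (r.comp p) x =
      eqToHom (by rw [D.pathFunctor'_comp_obj]) ≫ S.canH p ((D.pathFunctor' r).obj x) ≫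
        (S.shP p).map (S.canH r x) ≫ eqToHom (by rw [S.shP_comp_obj])
  | _, .nil, x => by
    exact (show S.canH r x = 𝟙 _ ≫ 𝟙 _ ≫ S.canH r x ≫ 𝟙 _ by simp)
  | b, .cons p e, x => by
    have IH := canH_comp r p x
    change S.canH ((r.comp p).cons e) x = _
    rw [canH_cons, IH, canH_cons, shP_cons_map]
    simp only [Functor.map_comp, eqToHom_map]
    rw [S.canE_eqToHom_assoc e (D.pathFunctor'_comp_obj r p x)]
    erw [Category.assoc]
    try rfl

/-- The path-composition law for `can_[γ]⁻¹`. [cite: MochizukiAbsTopIII2015, Definition 3.5 (ii) p.75] -/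
theorem canI_comp {c a : V} (r : Path c a) : ∀ {b : V} (p : Path a b) (x : D.obj c),
    S.canI (r.comp p) x =
      eqToHom (by rw [S.shP_comp_obj]) ≫ (S.shP p).map (S.canI r x) ≫
        S.canI p ((D.pathFunctor' r).obj x) ≫ eqToHom (by rw [D.pathFunctor'_comp_obj])
  | _, .nil, x => by
    exact (show S.canI r x = 𝟙 _ ≫ S.canI r x ≫ 𝟙 _ ≫ 𝟙 _ by simp)
  | b, .cons p e, x => by
    have IH := canI_comp r p x
    change S.canI ((r.comp p).cons e) x = _
    rw [canI_cons, IH, canI_cons, shP_cons_map]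
    simp only [Functor.map_comp, eqToHom_map, Category.assoc]
    rw [← S.canEI_eqToHom e (D.pathFunctor'_comp_obj r p x).symm]
    erw [Category.assoc]
    try rfl

/-! ## The universal homotopy of a pair with equal shadows -/

section Universal

variable {a b : V} (hb : (S.aug b).FullyFaithful)

/-- **The universal homotopy** of a co-verticial pair with equal shadows: the unique natural transformation `𝒟_[γ₁] ⟶ 𝒟_[γ₂]` lying over `can_[γ₁] ≫ can_[γ₂]⁻¹`. [cite: MochizukiAbsTopIII2015, Definition 3.5 (ii) p.75] -/
noncomputable def univ (p q : Path a b) (h : S.shP p = S.shP q) :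
    D.pathFunctor' p ⟶ D.pathFunctor' q :=
  (hb.whiskeringRight (D.obj a)).preimage
    ((S.canP p).hom ≫ eqToHom (by rw [h]) ≫ (S.canP q).inv)

/-- The universal homotopy lies over `can_[γ₁] ≫ can_[γ₂]⁻¹` (components). [cite: MochizukiAbsTopIII2015, Definition 3.5 (ii) p.75] -/
theorem map_univ_app (p q : Path a b) (h : S.shP p = S.shP q) (x : D.obj a) :
    (S.aug b).map ((S.univ hb p q h).app x) =
      S.canH p x ≫ eqToHom (by rw [h]) ≫ S.canI q x := by
  unfold univ
  rw [Functor.FullyFaithful.whiskeringRight_preimage_app, Functor.FullyFaithful.map_preimage,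
    NatTrans.comp_app, NatTrans.comp_app, eqToHom_app]
  rfl

/-- **Uniqueness**: a natural transformation lying over `can_[γ₁] ≫ can_[γ₂]⁻¹` IS the universal homotopy. [cite: MochizukiAbsTopIII2015, Definition 3.5 (ii) p.75] -/
theorem univ_eq {p q : Path a b} (h : S.shP p = S.shP q)
    (φ : D.pathFunctor' p ⟶ D.pathFunctor' q)
    (hφ : ∀ x, (S.aug b).map (φ.app x) = S.canH p x ≫ eqToHom (by rw [h]) ≫ S.canI q x) :
    φ = S.univ hb p q h := by
  ext x
  exact hb.map_injective ((hφ x).trans (S.map_univ_app hb p q h x).symm)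

/-- Axiom `ζ_{([γ],[γ])} = id`. [cite: MochizukiAbsTopIII2015, Definition 3.5 (ii) p.75] -/
theorem univ_refl (p : Path a b) : S.univ hb p p rfl = 𝟙 _ :=
  (S.univ_eq hb rfl (𝟙 _) fun x => by simp).symm

/-- Axiom `ζ_{ϖ''} = ζ_{ϖ'} ∘ ζ_ϖ`. [cite: MochizukiAbsTopIII2015, Definition 3.5 (ii) p.75] -/
theorem univ_trans (p q r : Path a b) (h₁ : S.shP p = S.shP q) (h₂ : S.shP q = S.shP r) :
    S.univ hb p r (h₁.trans h₂) = S.univ hb p q h₁ ≫ S.univ hb q r h₂ :=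
  (S.univ_eq hb _ _ fun x => by
    rw [NatTrans.comp_app, Functor.map_comp, map_univ_app, map_univ_app]
    simp only [Category.assoc, canI_canH_assoc, eqToHom_trans_assoc]).symm

end Universal

/-! ## The whiskering axiom -/

/-- The shadow of `𝒟_[γ₂](ζ_x)` for `ζ_x` lying over `u ≫ u'`, via a natural family `ch` with right inverse `ci`. [folklore] -/
private theorem shadow_whisker_aux {A B C Y Y₀ Z : Type u} [Category.{v} A] [Category.{v} B]
    [Category.{v} C] [Category.{v} Y] [Category.{v} Y₀] [Category.{v} Z]
    {P Q : A ⥤ B} {R : B ⥤ C} {tB : B ⥤ Y} {tC : C ⥤ Z} {sP : Y₀ ⥤ Y} (sR : Y ⥤ Z)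
    (ch : ∀ z : B, tC.obj (R.obj z) ⟶ sR.obj (tB.obj z))
    (ci : ∀ z : B, sR.obj (tB.obj z) ⟶ tC.obj (R.obj z))
    (hnat : ∀ {z z' : B} (g : z ⟶ z'), tC.map (R.map g) ≫ ch z' = ch z ≫ sR.map (tB.map g))
    (hci : ∀ z : B, ch z ≫ ci z = 𝟙 _)
    {y : A} {t : Y₀} (f : P.obj y ⟶ Q.obj y)
    (u : tB.obj (P.obj y) ⟶ sP.obj t) (u' : sP.obj t ⟶ tB.obj (Q.obj y)) (hf : tB.map f = u ≫ u') :
    tC.map (R.map f) = ch (P.obj y) ≫ sR.map u ≫ sR.map u' ≫ ci (Q.obj y) := by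
  have nat := congrArg (· ≫ ci (Q.obj y)) (hnat f)
  simp only [Category.assoc, hci, Category.comp_id] at nat
  rw [nat, hf, Functor.map_comp, Category.assoc]

/-- For EQUAL functors `F = G`, `H(F u) ≫ eqToHom ≫ H(G u⁻¹)` is an `eqToHom`. [folklore] -/
private theorem map_map_cancel {A B C : Type u} [Category.{v} A] [Category.{v} B] [Category.{v} C]
    {F G : A ⥤ B} (hFG : F = G) (H : B ⥤ C) {s t : A} (u : s ⟶ t) (u' : t ⟶ s)
    (huu' : u ≫ u' = 𝟙 s) {W : C} (k : H.obj (G.obj s) ⟶ W) :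
    H.map (F.map u) ≫ eqToHom (by rw [hFG]) ≫ H.map (G.map u') ≫ k = eqToHom (by rw [hFG]) ≫ k := by
  subst hFG
  rw [eqToHom_refl, eqToHom_refl, Category.id_comp, Category.id_comp, ← Category.assoc,
    ← Functor.map_comp, ← Functor.map_comp, huu', Functor.map_id, Functor.map_id, Category.id_comp]

/-- Whiskering axiom `ζ_{([γ₃]∘[γ₁]∘[γ₄],[γ₃]∘[γ₂]∘[γ₄])} = 𝒟_[γ₃] ∘ ζ_ϖ ∘ 𝒟_[γ₄]` for the universal homotopies. [cite: MochizukiAbsTopIII2015, Definition 3.5 (ii) p.75] -/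
theorem univ_whisker {a b c d : V} (hb : (S.aug b).FullyFaithful) (hd : (S.aug d).FullyFaithful)
    (p q : Path a b) (h : S.shP p = S.shP q) (r₁ : Path c a) (r₂ : Path b d)
    (H : S.shP (r₁.comp (p.comp r₂)) = S.shP (r₁.comp (q.comp r₂)))
    (h₁ : D.pathFunctor' (r₁.comp (p.comp r₂)) =
      D.pathFunctor' r₁ ⋙ D.pathFunctor' p ⋙ D.pathFunctor' r₂)
    (h₂ : D.pathFunctor' r₁ ⋙ D.pathFunctor' q ⋙ D.pathFunctor' r₂ =
      D.pathFunctor' (r₁.comp (q.comp r₂))) :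
    S.univ hd (r₁.comp (p.comp r₂)) (r₁.comp (q.comp r₂)) H =
      eqToHom h₁ ≫ Functor.whiskerLeft (D.pathFunctor' r₁)
        (Functor.whiskerRight (S.univ hb p q h) (D.pathFunctor' r₂)) ≫ eqToHom h₂ := by
  symm
  refine S.univ_eq hd H _ fun x => ?_
  rw [NatTrans.comp_app, NatTrans.comp_app, eqToHom_app, eqToHom_app, Functor.whiskerLeft_app,
    Functor.whiskerRight_app, Functor.map_comp, Functor.map_comp, eqToHom_map, eqToHom_map]
  symm
  refine (conj_eqToHom_iff_heq' _ _ _ _).mpr ?_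
  show _ ≍ (S.aug d).map ((D.pathFunctor' r₂).map ((S.univ hb p q h).app ((D.pathFunctor' r₁).obj x)))
  -- the whiskered homotopy, through the naturality of `can_[γ₄]`
  rw [shadow_whisker_aux (S.shP r₂) (fun z => S.canH r₂ z) (fun z => S.canI r₂ z)
    (fun g => S.canH_naturality r₂ g) (fun z => S.canH_canI r₂ z)
    ((S.univ hb p q h).app ((D.pathFunctor' r₁).obj x)) (S.canH p _)
    (eqToHom (by rw [h]) ≫ S.canI q _) (S.map_univ_app hb p q h _),
    Functor.map_comp, eqToHom_map]
  -- the composite 2-cells, decomposed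
  rw [S.canH_comp r₁ (p.comp r₂), S.canH_comp p r₂, S.canI_comp r₁ (q.comp r₂), S.canI_comp q r₂,
    shP_comp_map, shP_comp_map]
  simp only [Category.assoc, eqToHom_trans, eqToHom_trans_assoc, eqToHom_refl, Category.id_comp]
  rw [map_map_cancel h (S.shP r₂) (S.canH r₁ x) (S.canI r₁ x) (S.canH_canI r₁ x)]
  simp only [eqToHom_comp_heq_iff]
  have eO : (D.pathFunctor' (r₁.comp (q.comp r₂))).obj x =
      (D.pathFunctor' r₂).obj ((D.pathFunctor' q).obj ((D.pathFunctor' r₁).obj x)) := by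
    rw [D.pathFunctor'_comp_obj, D.pathFunctor'_comp_obj]
  have eT := congrArg (S.aug d).obj eO
  exact heq_comp rfl rfl eT HEq.rfl (heq_comp rfl rfl eT HEq.rfl (heq_comp rfl rfl eT HEq.rfl
    (heq_comp rfl rfl eT HEq.rfl (comp_eqToHom_heq _ _))))

/-! ## The canonical family and the generated families -/

variable (ff : ∀ b : V, (S.aug b).FullyFaithful)

/-- **The canonical family of homotopies** of a pseudo-commuting shadow with fully faithful augmentations: boundary set "equal shadows", universal homotopies. [cite: MochizukiAbsTopIII2015, Definition 3.5 (ii) p.75] -/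
noncomputable def shadowFamily : D.HomotopyFamily :=
  HomotopyFamily.mkOfStrict (fun ⦃_ _ : V⦄ p q => S.shP p = S.shP q) S.isSaturated_shEq
    (fun ⦃_ b⦄ ⦃p q⦄ h => S.univ (ff b) p q h)
    (fun ⦃_ b⦄ ⦃p⦄ _ => S.univ_refl (ff b) p)
    (fun ⦃_ b⦄ ⦃p q r⦄ h₁ h₂ => S.univ_trans (ff b) p q r h₁ h₂)
    (fun ⦃_ b _ d⦄ ⦃p q⦄ h r₁ r₂ => S.univ_whisker (ff b) (ff d) p q h r₁ r₂ _ _ _)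

section Generated

variable (E₀ : ∀ ⦃a b : V⦄, Path a b → Path a b → Prop)
  (hE₀ : ∀ ⦃a b : V⦄ ⦃p q : Path a b⦄, E₀ p q → S.shP p = S.shP q)

include hE₀

/-- Pairs in the saturation of generators with equal shadows have equal shadows. [cite: MochizukiAbsTopIII2015, Section 0 p.27] -/
theorem shP_eq_of_saturation {a b : V} {p q : Path a b} (h : Saturation E₀ p q) :
    S.shP p = S.shP q :=
  saturation_le S.isSaturated_shEq hE₀ h

/-- **The family of homotopies GENERATED by `E₀`** (boundary set = the saturation of `E₀`), for generators with equal shadows. [cite: MochizukiAbsTopIII2015, Definition 3.5 (ii) p.75] -/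
noncomputable def generatedFamily : D.HomotopyFamily :=
  (S.shadowFamily ff).restrict (Saturation E₀) (isSaturated_saturation E₀)
    (fun ⦃_ _⦄ ⦃_ _⦄ h => S.shP_eq_of_saturation E₀ hE₀ h)

/-- The generated family IS generated by `E₀`. [cite: MochizukiAbsTopIII2015, Definition 3.5 (ii) p.75] -/
theorem generatedFamily_isGeneratedBy :
    HomotopyFamily.IsGeneratedBy D (S.generatedFamily ff E₀ hE₀) E₀ := fun _ _ _ _ => Iff.rfl

/-- The generators belong to the boundary set of the generated family. [cite: MochizukiAbsTopIII2015, Definition 3.5 (ii) p.75] -/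
theorem generatedFamily_mem {a b : V} {p q : Path a b} (h : E₀ p q) :
    (S.generatedFamily ff E₀ hE₀).E p q := Saturation.base h

/-- **Uniqueness for the generated family**: a natural transformation (t2's `pathFunctor`) lying over `can_[γ₁] ≫ can_[γ₂]⁻¹` is the family's homotopy. [cite: MochizukiAbsTopIII2015, Definition 3.5 (ii) p.75] -/
theorem generatedFamily_η_eq {a b : V} {p q : Path a b} (h : (S.generatedFamily ff E₀ hE₀).E p q)
    (φ : D.pathFunctor p ⟶ D.pathFunctor q)
    (hφ : ∀ x, (S.aug b).map (φ.app x) ≍ S.canH p x ≫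
      eqToHom (by rw [S.shP_eq_of_saturation E₀ hE₀ h]) ≫ S.canI q x) :
    φ = (S.generatedFamily ff E₀ hE₀).η h := by
  show φ = eqToHom (D.pathFunctor_eq_pathFunctor' p) ≫
    S.univ (ff b) p q (S.shP_eq_of_saturation E₀ hE₀ h) ≫
    eqToHom (D.pathFunctor_eq_pathFunctor' q).symm
  have hu := S.univ_eq (ff b) (S.shP_eq_of_saturation E₀ hE₀ h)
    (eqToHom (D.pathFunctor_eq_pathFunctor' p).symm ≫ φ ≫ eqToHom (D.pathFunctor_eq_pathFunctor' q))
    fun x => by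
      rw [NatTrans.comp_app, NatTrans.comp_app, eqToHom_app, eqToHom_app, Functor.map_comp,
        Functor.map_comp, eqToHom_map, eqToHom_map]
      exact ((conj_eqToHom_iff_heq' _ _ _ _).mpr (hφ x).symm).symm
  rw [← hu]
  simp

end Generated

end PseudoShadow

end DiagramOfCategories

end Literature.AnabelianGeometry.AbsoluteAnabelian
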